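import Summits.HodgeConjecture.HodgeConjecture.Theorems.P2StubU2OfLettersCadmD
import Summits.HodgeConjecture.HodgeConjecture.Theorems.F0P2cStubCLLocalTypeExists
import Summits.HodgeConjecture.HodgeConjecture.Theorems.F0P2dSocketD
import HarnessLib

/-!
# Crux `H413`, (C) desk — THE (C♭) SOCKET AND THE CRUX AT THEOREMS LEVEL FROM THE (C)-LINE'S STUBS CE ∕ CF ∕ CI, BY NAME
# (CL DISCHARGED — ★ `F0P2cStubCLLocalTypeExists.stubCL_holds`; (D) DISCHARGED — ★ `F0P2dSocketD.holCotFormSpectralProjection_holds`)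

Cell hodgecm-mathlib (D-0151), FLOOR 0, crux item H413 = stmt-HodgeConjecture-24833; programme P2; (C)-desk sub-line
`Cruxes/H413/Lines/F0_P2CohFinComponentIsThetaC.lean` (planner F0P2-plan (g3), registrar A-plan1 (g18); four registered stubs CE ∕ CL ∕ CF ∕ CI, head (C♭)).
Author F0P2-p01 (g3).  THEOREMS ONLY (no `def`, no instance, no named fact, no `sorry`); `--supports stmt-HodgeConjecture-24833 --as helper`;
never imports a `Cruxes/…/Lines` module (s380b) — the stub bodies are RESTATED VERBATIM with the Lines-local bundle
`IsLocalTypeAt F E c N J ρ v τ := τ.IsIrreducible ∧ isotypicComponent ℂ[U(J)(F_v)] (ρ.comp (inclPlace F E c N J v)).asModule τ.asModule = ⊤` UNFOLDED (s347).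
HC_CM is proved only modulo the printed citations until rung 0 closes; this file proves nothing about them — it is the ONE kernel term exhibiting the
(C♭) socket and the crux as functions of EXACTLY the open stubs, the Theorems-level twin of the line's heads `cohFinComponentIsThetaAdm_of_stubs` ∕
`H413_of_stubs` with everything that is ★ plugged in BY NAME (the p01-lineage job, cf. ★ `F0P2dSocketDOfStubs` → ★ `F0P2dSocketD` for the (D) desk).

THE SOCKET (C♭) (F0P2-plan (g3) ruling (A), 2026-08-31T00:52:36Z, after F0P2-p02 (g2)) = ★ `Rogawski1990.cohFinComponent_isTheta` with ONE extra binder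
`σ.IsAdmissible →` after `σ.IsSmooth →` = the hypothesis text of ★ `P2StubU2OfLettersCadmD.stub_U2_cohFormsSpectrumIsThetaAt_of_Cadm_D` (p798914): every irreducible
smooth ADMISSIBLE `σ` of `U(H)(𝔸_{L⁺,f})` occurring in a discrete automorphic `P` of (anti)holomorphic cotangent type at the indefinite place EMBEDS into Liu's
carrier `ω_H = rhoAtLine … ιV a χ` for ONE global datum (`μ` conjugate-symplectic of weight one, `a ∈ (L⁺)ˣ`, `χ`).

THE CUT (per place, on `U(H)`'s own local groups `U(J)(F_v) = UnitaryGroup.localPi E c N J v`, ★ `UnitaryGroup.inclPlace`):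
* **CE** (`hCE`, ENGINE letter, class U; registered body, ruling (B)(iv)): for the socket's data, ONE global `(μ, a, χ)` such that AT EVERY FINITE PLACE every
  irreducible local type of `σ` is a local type of `ω_H` [Rogawski1990 Thm 13.3.6 (c), §12.3, §14.6; Rogawski1992 Thm 1.1; GelbartRogawski1991 Thm 5.1.1,
  Lem 5.1.2; HarrisKudlaSweet1996 Thm 6.1; Liu2021 Def 4.11, Rem 4.14, App. D];
* **CL** — irreducible admissible `σ` of `U(J)(𝔸_{F,f})` has an irreducible local type at every place: ★ `F0P2cStubCLLocalTypeExists.stubCL_holds` (F0P2-p03 (g2),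
  p799835; Flath purification ★ `FlathBaseVector.exists_purified_at`) — DISCHARGED HERE BY NAME, not a hypothesis;
* **CF** (`hCF`, in-house, A-p08 (g16)'s road; registered body, ruling (B)(iii): BOTH sides irreducible admissible): a common irreducible local type at every place
  ⇒ an injective intertwiner `σ → ω` [Flath1979 Thm 3; BorelJacquet1979 §4.3];
* **CI** (`hCI`; registered body): `ω_H` is irreducible and admissible for every frame datum and every `(μ, a, χ)` [Liu2021 Lem D.1 (1)(3); HarrisKudlaSweet1996].

* `cohFinComponentIsThetaAdm_of_CE_CF_CI (hCE) (hCF) (hCI) : ‹(C♭)›` — 8 lines of logic: CE gives `(μ, a, χ)` and the type inclusion, CL (★) the local types of the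
  admissible `σ`, CI irreducibility + admissibility of `ω_H`, CF the injective intertwiner;
* **`H413_of_CE_CF_CI_U4 (hCE) (hCF) (hCI) (hU4) (hJ3a) (hocc) : HCCMUnconditional.H413`** := ★ `Hyp413Closing.H413_of_three_facts_flat` ∘ ★
  `oscillatorTriple_dictionaryExistence_holds_of` (U1′ ★ `TowerRealisation.stubU1RealisationAt_holds`, U2′ ★ p798914
  `P2StubU2OfLettersCadmD.stub_U2_cohFormsSpectrumIsThetaAt_of_Cadm_D` at (C♭) := the above and (D) := ★ `F0P2dSocketD.holCotFormSpectralProjection_holds`) — the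
  floor-0 P2 census in ONE signature: {CE, CF, CI, U4} ∪ rows {J3a (P3), occ (P4)}; (C′), (D), (D̄), CL gone BY NAME.  APPEND-ONLY successors discharge CF (A-p08's closer) and CI
  (F0P2-p02 (g2)) as they land; end state `H413_of_CE_U4`.

## References
* [Flath1979] D. Flath, Decomposition of representations into tensor products, PSPM 33.1 (1979): Thm 2, Thm 3, §2 Ex. 2.
* [BorelJacquet1979] A. Borel, H. Jacquet, Automorphic forms and automorphic representations, PSPM 33.1: §4.3, §4.6.
* [Rogawski1990] J. Rogawski, Automorphic representations of unitary groups in three variables, Ann. of Math. Stud. 123: Thm 13.3.1, Thm 13.3.6 (c), §12.3, §14.6.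
* [Rogawski1992] J. Rogawski, The multiplicity formula for A-packets (1992): Thm 1.1.
* [GelbartRogawski1991] S. Gelbart, J. Rogawski, Invent. Math. 105 (1991): Thm 5.1.1, Lem 5.1.2.
* [HarrisKudlaSweet1996] M. Harris, S. Kudla, W. J. Sweet, J. AMS 9 (1996): Thm 6.1.
* [Liu2021] Y. Liu, Camb. J. Math. 9 (2021) = arXiv:2102.11518: Def 4.11, Prop 4.13 and proof l. 2121–2146, Rem 4.14, App. D Lem D.1 (1)(3).
-/

set_option autoImplicit false

-- the mandated namespace has the single-problem summit's repeated segment (`HodgeConjecture.HodgeConjecture`)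
set_option linter.dupNamespace false

noncomputable section

namespace Summit.HodgeConjecture.HodgeConjecture.Cruxes.H413.F0P2cSocketCOfStubs

open NumberField MeasureTheory IsDedekindDomain
open scoped Matrix ComplexOrder
open Literature.NumberTheory.Automorphic Literature.NumberTheory.Automorphic.UnitaryGroup
open Literature.NumberTheory.Automorphic.UnitaryGroup.CotangentForms
open Literature.NumberTheory.Automorphic.IdeleClassGroup
open Literature.NumberTheory.Automorphic.Liu2021 Literature.NumberTheory.Automorphic.Liu2021.Def411WeilCarriers
open Literature.NumberTheory.Automorphic.Liu2021.Def411WeilCarriersDoubling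
open Literature.NumberTheory.GelbartRogawski1991 Literature.NumberTheory.GelbartRogawski1991.UnitaryDualPair
open Literature.RepresentationTheory.Liu2021
open Literature.NumberTheory.Rogawski1990
open Summit.HodgeConjecture.HodgeConjecture.Cruxes.H413.SpectrumInterfaces (StubU4SignRule HJ3aType HoccType
  oscillatorTriple_dictionaryExistence_holds_of)

/-! ## §1  The (C♭) socket from CE, CF, CI (CL ★) -/

set_option synthInstance.maxHeartbeats 400000 in
set_option maxHeartbeats 8000000 in
/-- **The (C♭) socket — «(C) for admissible `σ`» — from the registered stubs CE, CF, CI of the (C)-line, with CL DISCHARGED by ★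
`F0P2cStubCLLocalTypeExists.stubCL_holds`.**  Pure logic: CE gives the global datum `(μ, a, χ)` and the place-by-place type inclusion `σ ⇝ ω_H`, CL produces
an irreducible local type of the admissible `σ` at every finite place, CI makes `ω_H` irreducible admissible, CF assembles the injective intertwiner
`σ → ω_H`.  The three hypotheses are the registered bodies (F0P2-plan (g3) ruling (B), 2026-08-31T00:52:36Z) with `IsLocalTypeAt` unfolded.
[cite: Flath1979, Thm 3] [cite: Rogawski1990, Thm 13.3.6 (c)] [cite: Liu2021, Def 4.11, Rem 4.14, App. D Lem D.1] -/
theorem cohFinComponentIsThetaAdm_of_CE_CF_CI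
    (hCE :
      ∀ (L : Type) [Field L] [NumberField L] [IsCMField L] (ι : L →+* ℂ) (H : Matrix (Fin 3) (Fin 3) L) (T : GL (Fin 3) ℂ)
        (hT : (T : Matrix (Fin 3) (Fin 3) ℂ)ᴴ * H.map ι * (T : Matrix (Fin 3) (Fin 3) ℂ) = Literature.Geometry.ComplexHyperbolic.BallModel.J),
        (∀ τ' : L →+* ℂ, InfinitePlace.mk τ' ≠ InfinitePlace.mk ι → (H.map τ').PosDef) → 2 ≤ Module.finrank ℚ ↥(maximalRealSubfield L) →
        ∀ {n' : ℕ} (e₁ : Fin 3 × Fin 1 ≃ Fin n') (dV : Fin 3 → L) (hdV : ∀ i, IsCMField.complexConj L (dV i) = dV i)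
          (hdV0 : ∀ i, dV i ≠ 0) (g : GL (Fin 3) L),
          ((g : Matrix (Fin 3) (Fin 3) L).map (cmConjRingHom L))ᵀ * H * (g : Matrix (Fin 3) (Fin 3) L) = Matrix.diagonal dV →
          ∀ (ιV : finAdelic (↥(maximalRealSubfield L)) L (IsCMField.complexConj L) 3 H →*
              finAdelic (↥(maximalRealSubfield L)) L (IsCMField.complexConj L) 3 (Matrix.diagonal dV)),
            (∀ k, ((ιV k : finAdelic (↥(maximalRealSubfield L)) L (IsCMField.complexConj L) 3 (Matrix.diagonal dV)) :
                GL (Fin 3) (FiniteAdeleRing (𝓞 L) L)) =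
              (toFinAdeleGL L 3 g)⁻¹ * (k : GL (Fin 3) (FiniteAdeleRing (𝓞 L) L)) * toFinAdeleGL L 3 g) →
            ∀ (μ : Measure (adelicGroupData (↥(maximalRealSubfield L)) L (IsCMField.complexConj L) 3 H).automorphicQuotient)
              [(adelicGroupData (↥(maximalRealSubfield L)) L (IsCMField.complexConj L) 3 H).IsAutomorphicMeasure μ]
              (W : Type) [AddCommGroup W] [Module ℂ W]
              (σ : Representation ℂ (finAdelic (↥(maximalRealSubfield L)) L (IsCMField.complexConj L) 3 H) W),
              σ.IsIrreducible → σ.IsSmooth → σ.IsAdmissible →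
              ∀ P : DiscreteAutomorphicRep (adelicGroupData (↥(maximalRealSubfield L)) L (IsCMField.complexConj L) 3 H) μ,
                (P.IsHolCotangentAt (cmArchSection L ι H T hT) (cmCompactFactor L ι H T hT) ∨
                  P.IsAntiholCotangentAt (cmArchSection L ι H T hT) (cmCompactFactor L ι H T hT)) →
                P.HasFinComponent σ →
                ∃ (μ : Literature.NumberTheory.Automorphic.IdeleClassGroup L →ₜ* Circle) (hμ : IsConjugateSymplectic L μ), HasWeight L μ 1 ∧
                  ∃ (a : (↥(maximalRealSubfield L))ˣ) (χ : Chi (↥(maximalRealSubfield L)) L (IsCMField.complexConj L)),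
                    ∀ (v : HeightOneSpectrum (𝓞 ↥(maximalRealSubfield L))) (Tv : Type) [AddCommGroup Tv] [Module ℂ Tv]
                      (τ : Representation ℂ (localPi L (IsCMField.complexConj L) 3 H v) Tv),
                      (τ.IsIrreducible ∧
                        isotypicComponent (MonoidAlgebra ℂ (localPi L (IsCMField.complexConj L) 3 H v))
                          (Representation.asModule (σ.comp (inclPlace (↥(maximalRealSubfield L)) L (IsCMField.complexConj L) 3 H v)))
                          (Representation.asModule τ) = ⊤) →
                      (τ.IsIrreducible ∧
                        isotypicComponent (MonoidAlgebra ℂ (localPi L (IsCMField.complexConj L) 3 H v))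
                          (Representation.asModule
                            ((rhoAtLine (↥(maximalRealSubfield L)) L (IsCMField.complexConj L) 3 e₁ (Matrix.diagonal dV)
                        (complexConj_imagUnit L) (imagUnit_ne_zero L) (imagUnit_mul_self L) (realDiagonal_isSymm L dV hdV)
                        (isUnit_det_realDiagonal L dV hdV hdV0) (realDiagonal_map L dV hdV).symm
                        (fun a => isCompatible_chiSplittingLine L e₁ dV hdV hdV0 (toHeckeCharacter L μ)
                          (isUnitary_toHeckeCharacter L μ) ((isOscillatorChar_toHeckeCharacter_iff μ).mpr hμ)
                          (TW (↥(maximalRealSubfield L)) a) (isSymm_TW (↥(maximalRealSubfield L)) a)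
                          (isUnit_det_TW (↥(maximalRealSubfield L)) a) (JW (↥(maximalRealSubfield L)) L a)
                          (JW_eq (↥(maximalRealSubfield L)) L a)) ιV a χ).comp
                              (inclPlace (↥(maximalRealSubfield L)) L (IsCMField.complexConj L) 3 H v)))
                          (Representation.asModule τ) = ⊤))
    (hCF :
      ∀ (F E : Type) [Field F] [NumberField F] [Field E] [NumberField E] [Algebra F E] (c : E ≃ₐ[F] E) (N : ℕ)
        (J : Matrix (Fin N) (Fin N) E) (W W' : Type) [AddCommGroup W] [Module ℂ W] [AddCommGroup W'] [Module ℂ W']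
        (σ : Representation ℂ (finAdelic F E c N J) W) (ω : Representation ℂ (finAdelic F E c N J) W'),
        σ.IsIrreducible → σ.IsAdmissible → ω.IsIrreducible → ω.IsAdmissible →
          (∀ v : HeightOneSpectrum (𝓞 F), ∃ (T : Type) (_ : AddCommGroup T) (_ : Module ℂ T) (τ : Representation ℂ (localPi E c N J v) T),
            (τ.IsIrreducible ∧
              isotypicComponent (MonoidAlgebra ℂ (localPi E c N J v)) (Representation.asModule (σ.comp (inclPlace F E c N J v)))
                (Representation.asModule τ) = ⊤) ∧
            (τ.IsIrreducible ∧
              isotypicComponent (MonoidAlgebra ℂ (localPi E c N J v)) (Representation.asModule (ω.comp (inclPlace F E c N J v)))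
                (Representation.asModule τ) = ⊤)) →
          ∃ f : σ.IntertwiningMap ω, Function.Injective f)
    (hCI :
      ∀ (L : Type) [Field L] [NumberField L] [IsCMField L] (H : Matrix (Fin 3) (Fin 3) L)
        {n' : ℕ} (e₁ : Fin 3 × Fin 1 ≃ Fin n') (dV : Fin 3 → L) (hdV : ∀ i, IsCMField.complexConj L (dV i) = dV i) (hdV0 : ∀ i, dV i ≠ 0)
        (g : GL (Fin 3) L),
        ((g : Matrix (Fin 3) (Fin 3) L).map (cmConjRingHom L))ᵀ * H * (g : Matrix (Fin 3) (Fin 3) L) = Matrix.diagonal dV →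
        ∀ (ιV : finAdelic (↥(maximalRealSubfield L)) L (IsCMField.complexConj L) 3 H →*
            finAdelic (↥(maximalRealSubfield L)) L (IsCMField.complexConj L) 3 (Matrix.diagonal dV)),
          (∀ k, ((ιV k : finAdelic (↥(maximalRealSubfield L)) L (IsCMField.complexConj L) 3 (Matrix.diagonal dV)) :
              GL (Fin 3) (FiniteAdeleRing (𝓞 L) L)) =
            (toFinAdeleGL L 3 g)⁻¹ * (k : GL (Fin 3) (FiniteAdeleRing (𝓞 L) L)) * toFinAdeleGL L 3 g) →
          ∀ (μ : Literature.NumberTheory.Automorphic.IdeleClassGroup L →ₜ* Circle) (hμ : IsConjugateSymplectic L μ), HasWeight L μ 1 →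
            ∀ (a : (↥(maximalRealSubfield L))ˣ) (χ : Chi (↥(maximalRealSubfield L)) L (IsCMField.complexConj L)),
              (rhoAtLine (↥(maximalRealSubfield L)) L (IsCMField.complexConj L) 3 e₁ (Matrix.diagonal dV) (complexConj_imagUnit L)
                  (imagUnit_ne_zero L) (imagUnit_mul_self L) (realDiagonal_isSymm L dV hdV) (isUnit_det_realDiagonal L dV hdV hdV0)
                  (realDiagonal_map L dV hdV).symm
                  (fun a => isCompatible_chiSplittingLine L e₁ dV hdV hdV0 (toHeckeCharacter L μ) (isUnitary_toHeckeCharacter L μ)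
                    ((isOscillatorChar_toHeckeCharacter_iff μ).mpr hμ) (TW (↥(maximalRealSubfield L)) a)
                    (isSymm_TW (↥(maximalRealSubfield L)) a) (isUnit_det_TW (↥(maximalRealSubfield L)) a)
                    (JW (↥(maximalRealSubfield L)) L a) (JW_eq (↥(maximalRealSubfield L)) L a)) ιV a χ).IsIrreducible ∧
              (rhoAtLine (↥(maximalRealSubfield L)) L (IsCMField.complexConj L) 3 e₁ (Matrix.diagonal dV) (complexConj_imagUnit L)
                  (imagUnit_ne_zero L) (imagUnit_mul_self L) (realDiagonal_isSymm L dV hdV) (isUnit_det_realDiagonal L dV hdV hdV0)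
                  (realDiagonal_map L dV hdV).symm
                  (fun a => isCompatible_chiSplittingLine L e₁ dV hdV hdV0 (toHeckeCharacter L μ) (isUnitary_toHeckeCharacter L μ)
                    ((isOscillatorChar_toHeckeCharacter_iff μ).mpr hμ) (TW (↥(maximalRealSubfield L)) a)
                    (isSymm_TW (↥(maximalRealSubfield L)) a) (isUnit_det_TW (↥(maximalRealSubfield L)) a)
                    (JW (↥(maximalRealSubfield L)) L a) (JW_eq (↥(maximalRealSubfield L)) L a)) ιV a χ).IsAdmissible) :
      ∀ (L : Type) [Field L] [NumberField L] [IsCMField L] (ι : L →+* ℂ) (H : Matrix (Fin 3) (Fin 3) L) (T : GL (Fin 3) ℂ)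
        (hT : (T : Matrix (Fin 3) (Fin 3) ℂ)ᴴ * H.map ι * (T : Matrix (Fin 3) (Fin 3) ℂ) = Literature.Geometry.ComplexHyperbolic.BallModel.J),
        (∀ τ' : L →+* ℂ, InfinitePlace.mk τ' ≠ InfinitePlace.mk ι → (H.map τ').PosDef) →
        2 ≤ Module.finrank ℚ ↥(maximalRealSubfield L) →
        -- the ω-side frame data (lane convention: diagonal Gram matrix over `L⁺`) and the frame transport, pinned extensionally
        ∀ {n' : ℕ} (e₁ : Fin 3 × Fin 1 ≃ Fin n') (dV : Fin 3 → L) (hdV : ∀ i, IsCMField.complexConj L (dV i) = dV i)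
          (hdV0 : ∀ i, dV i ≠ 0) (g : GL (Fin 3) L),
          ((g : Matrix (Fin 3) (Fin 3) L).map (cmConjRingHom L))ᵀ * H * (g : Matrix (Fin 3) (Fin 3) L) = Matrix.diagonal dV →
        ∀ (ιV : finAdelic (↥(maximalRealSubfield L)) L (IsCMField.complexConj L) 3 H →*
            finAdelic (↥(maximalRealSubfield L)) L (IsCMField.complexConj L) 3 (Matrix.diagonal dV)),
          (∀ k : finAdelic (↥(maximalRealSubfield L)) L (IsCMField.complexConj L) 3 H,
            ((ιV k : finAdelic (↥(maximalRealSubfield L)) L (IsCMField.complexConj L) 3 (Matrix.diagonal dV)) :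
                GL (Fin 3) (FiniteAdeleRing (𝓞 L) L)) =
              (toFinAdeleGL L 3 g)⁻¹ * (k : GL (Fin 3) (FiniteAdeleRing (𝓞 L) L)) * toFinAdeleGL L 3 g) →
        ∀ (μ : Measure (adelicGroupData (↥(maximalRealSubfield L)) L (IsCMField.complexConj L) 3 H).automorphicQuotient)
          [(adelicGroupData (↥(maximalRealSubfield L)) L (IsCMField.complexConj L) 3 H).IsAutomorphicMeasure μ]
          (W : Type) [AddCommGroup W] [Module ℂ W]
          (σ : Representation ℂ (finAdelic (↥(maximalRealSubfield L)) L (IsCMField.complexConj L) 3 H) W),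
          σ.IsIrreducible → σ.IsSmooth → σ.IsAdmissible →
        ∀ P : DiscreteAutomorphicRep (adelicGroupData (↥(maximalRealSubfield L)) L (IsCMField.complexConj L) 3 H) μ,
          (P.IsHolCotangentAt (cmArchSection L ι H T hT) (cmCompactFactor L ι H T hT) ∨
              P.IsAntiholCotangentAt (cmArchSection L ι H T hT) (cmCompactFactor L ι H T hT)) →
          P.HasFinComponent σ →
            ∃ (μ : Literature.NumberTheory.Automorphic.IdeleClassGroup L →ₜ* Circle)
              (hμ : Literature.NumberTheory.Automorphic.IdeleClassGroup.IsConjugateSymplectic L μ),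
              Literature.NumberTheory.Automorphic.IdeleClassGroup.HasWeight L μ 1 ∧
              ∃ (a : (↥(maximalRealSubfield L))ˣ) (χ : Chi (↥(maximalRealSubfield L)) L (IsCMField.complexConj L)),
                ∃ f : σ.IntertwiningMap
                    (rhoAtLine (↥(maximalRealSubfield L)) L (IsCMField.complexConj L) 3 e₁ (Matrix.diagonal dV)
                      (complexConj_imagUnit L) (imagUnit_ne_zero L) (imagUnit_mul_self L) (realDiagonal_isSymm L dV hdV)
                      (isUnit_det_realDiagonal L dV hdV hdV0) (realDiagonal_map L dV hdV).symm
                      (fun a => isCompatible_chiSplittingLine L e₁ dV hdV hdV0 (toHeckeCharacter L μ)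
                        (isUnitary_toHeckeCharacter L μ) ((isOscillatorChar_toHeckeCharacter_iff μ).mpr hμ)
                        (TW (↥(maximalRealSubfield L)) a) (isSymm_TW (↥(maximalRealSubfield L)) a)
                        (isUnit_det_TW (↥(maximalRealSubfield L)) a) (JW (↥(maximalRealSubfield L)) L a)
                        (JW_eq (↥(maximalRealSubfield L)) L a))
                      ιV a χ),
                  Function.Injective f := by
  intro L _ _ _ ι H T hT hdef h2 n' e₁ dV hdV hdV0 g hg ιV hιV μ _ W _ _ σ hirr hsm hadm P hP hfin
  -- CE: the global datum and the place-by-place type inclusion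
  obtain ⟨μ', hμ', hw, a, χ, hloc⟩ := hCE L ι H T hT hdef h2 e₁ dV hdV hdV0 g hg ιV hιV μ W σ hirr hsm hadm P hP hfin
  -- CI: `ω_H` is irreducible and admissible
  obtain ⟨hωirr, hωadm⟩ := hCI L H e₁ dV hdV hdV0 g hg ιV hιV μ' hμ' hw a χ
  -- CF over CL (★ `stubCL_holds`): the injective intertwiner
  obtain ⟨f, hf⟩ := hCF (↥(maximalRealSubfield L)) L (IsCMField.complexConj L) 3 H W _ σ _ hirr hadm hωirr hωadm fun v => by
    obtain ⟨Tv, _, _, τ, hτ, hστ⟩ :=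
      F0P2cStubCLLocalTypeExists.stubCL_holds (↥(maximalRealSubfield L)) L (IsCMField.complexConj L) 3 H W σ hirr hadm v
    exact ⟨Tv, inferInstance, inferInstance, τ, ⟨hτ, hστ⟩, hloc v Tv τ ⟨hτ, hστ⟩⟩
  exact ⟨μ', hμ', hw, a, χ, f, hf⟩

/-! ## §2  The crux from CE, CF, CI, U4 and the rows -/

set_option synthInstance.maxHeartbeats 400000 in
set_option maxHeartbeats 8000000 in
/-- **THE CRUX `HCCMUnconditional.H413` BY NAME FROM THE (C)-LINE'S OPEN STUBS CE (engine letter), CF (Flath rigidity), CI (`ω_H` irreducible admissible), THE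
SIGN RULE U4 AND THE FLOOR ROWS `hJ3a` (P3), `hocc` (P4)** — CL ★ p799835 and (D) ★ p799091 DISCHARGED BY NAME: ★ `Hyp413Closing.H413_of_three_facts_flat` over ★
`oscillatorTriple_dictionaryExistence_holds_of` at U1′ := ★ `TowerRealisation.stubU1RealisationAt_holds` and U2′ := ★ p798914
`P2StubU2OfLettersCadmD.stub_U2_cohFormsSpectrumIsThetaAt_of_Cadm_D (cohFinComponentIsThetaAdm_of_CE_CF_CI hCE hCF hCI) F0P2dSocketD.holCotFormSpectralProjection_holds`.  The
floor-0 P2 census of record read off one signature: {CE, CF, CI, U4} ∪ rows {J3a, occ}.  HC_CM is proved only modulo the printed citations until rung 0 closes.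
[cite: Liu2021, Prop. 4.13 and proof l. 2121–2146; Rem. 4.14] [cite: GelbartRogawski1991, Thm 5.1.1] [cite: Rogawski1990, Thm. 13.3.1, Thm. 13.3.6 (c)]
[cite: Flath1979, Thm 3] -/
theorem H413_of_CE_CF_CI_U4
    (hCE :
      ∀ (L : Type) [Field L] [NumberField L] [IsCMField L] (ι : L →+* ℂ) (H : Matrix (Fin 3) (Fin 3) L) (T : GL (Fin 3) ℂ)
        (hT : (T : Matrix (Fin 3) (Fin 3) ℂ)ᴴ * H.map ι * (T : Matrix (Fin 3) (Fin 3) ℂ) = Literature.Geometry.ComplexHyperbolic.BallModel.J),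
        (∀ τ' : L →+* ℂ, InfinitePlace.mk τ' ≠ InfinitePlace.mk ι → (H.map τ').PosDef) → 2 ≤ Module.finrank ℚ ↥(maximalRealSubfield L) →
        ∀ {n' : ℕ} (e₁ : Fin 3 × Fin 1 ≃ Fin n') (dV : Fin 3 → L) (hdV : ∀ i, IsCMField.complexConj L (dV i) = dV i)
          (hdV0 : ∀ i, dV i ≠ 0) (g : GL (Fin 3) L),
          ((g : Matrix (Fin 3) (Fin 3) L).map (cmConjRingHom L))ᵀ * H * (g : Matrix (Fin 3) (Fin 3) L) = Matrix.diagonal dV →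
          ∀ (ιV : finAdelic (↥(maximalRealSubfield L)) L (IsCMField.complexConj L) 3 H →*
              finAdelic (↥(maximalRealSubfield L)) L (IsCMField.complexConj L) 3 (Matrix.diagonal dV)),
            (∀ k, ((ιV k : finAdelic (↥(maximalRealSubfield L)) L (IsCMField.complexConj L) 3 (Matrix.diagonal dV)) :
                GL (Fin 3) (FiniteAdeleRing (𝓞 L) L)) =
              (toFinAdeleGL L 3 g)⁻¹ * (k : GL (Fin 3) (FiniteAdeleRing (𝓞 L) L)) * toFinAdeleGL L 3 g) →
            ∀ (μ : Measure (adelicGroupData (↥(maximalRealSubfield L)) L (IsCMField.complexConj L) 3 H).automorphicQuotient)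
              [(adelicGroupData (↥(maximalRealSubfield L)) L (IsCMField.complexConj L) 3 H).IsAutomorphicMeasure μ]
              (W : Type) [AddCommGroup W] [Module ℂ W]
              (σ : Representation ℂ (finAdelic (↥(maximalRealSubfield L)) L (IsCMField.complexConj L) 3 H) W),
              σ.IsIrreducible → σ.IsSmooth → σ.IsAdmissible →
              ∀ P : DiscreteAutomorphicRep (adelicGroupData (↥(maximalRealSubfield L)) L (IsCMField.complexConj L) 3 H) μ,
                (P.IsHolCotangentAt (cmArchSection L ι H T hT) (cmCompactFactor L ι H T hT) ∨
                  P.IsAntiholCotangentAt (cmArchSection L ι H T hT) (cmCompactFactor L ι H T hT)) →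
                P.HasFinComponent σ →
                ∃ (μ : Literature.NumberTheory.Automorphic.IdeleClassGroup L →ₜ* Circle) (hμ : IsConjugateSymplectic L μ), HasWeight L μ 1 ∧
                  ∃ (a : (↥(maximalRealSubfield L))ˣ) (χ : Chi (↥(maximalRealSubfield L)) L (IsCMField.complexConj L)),
                    ∀ (v : HeightOneSpectrum (𝓞 ↥(maximalRealSubfield L))) (Tv : Type) [AddCommGroup Tv] [Module ℂ Tv]
                      (τ : Representation ℂ (localPi L (IsCMField.complexConj L) 3 H v) Tv),
                      (τ.IsIrreducible ∧
                        isotypicComponent (MonoidAlgebra ℂ (localPi L (IsCMField.complexConj L) 3 H v))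
                          (Representation.asModule (σ.comp (inclPlace (↥(maximalRealSubfield L)) L (IsCMField.complexConj L) 3 H v)))
                          (Representation.asModule τ) = ⊤) →
                      (τ.IsIrreducible ∧
                        isotypicComponent (MonoidAlgebra ℂ (localPi L (IsCMField.complexConj L) 3 H v))
                          (Representation.asModule
                            ((rhoAtLine (↥(maximalRealSubfield L)) L (IsCMField.complexConj L) 3 e₁ (Matrix.diagonal dV)
                        (complexConj_imagUnit L) (imagUnit_ne_zero L) (imagUnit_mul_self L) (realDiagonal_isSymm L dV hdV)
                        (isUnit_det_realDiagonal L dV hdV hdV0) (realDiagonal_map L dV hdV).symm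
                        (fun a => isCompatible_chiSplittingLine L e₁ dV hdV hdV0 (toHeckeCharacter L μ)
                          (isUnitary_toHeckeCharacter L μ) ((isOscillatorChar_toHeckeCharacter_iff μ).mpr hμ)
                          (TW (↥(maximalRealSubfield L)) a) (isSymm_TW (↥(maximalRealSubfield L)) a)
                          (isUnit_det_TW (↥(maximalRealSubfield L)) a) (JW (↥(maximalRealSubfield L)) L a)
                          (JW_eq (↥(maximalRealSubfield L)) L a)) ιV a χ).comp
                              (inclPlace (↥(maximalRealSubfield L)) L (IsCMField.complexConj L) 3 H v)))
                          (Representation.asModule τ) = ⊤))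
    (hCF :
      ∀ (F E : Type) [Field F] [NumberField F] [Field E] [NumberField E] [Algebra F E] (c : E ≃ₐ[F] E) (N : ℕ)
        (J : Matrix (Fin N) (Fin N) E) (W W' : Type) [AddCommGroup W] [Module ℂ W] [AddCommGroup W'] [Module ℂ W']
        (σ : Representation ℂ (finAdelic F E c N J) W) (ω : Representation ℂ (finAdelic F E c N J) W'),
        σ.IsIrreducible → σ.IsAdmissible → ω.IsIrreducible → ω.IsAdmissible →
          (∀ v : HeightOneSpectrum (𝓞 F), ∃ (T : Type) (_ : AddCommGroup T) (_ : Module ℂ T) (τ : Representation ℂ (localPi E c N J v) T),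
            (τ.IsIrreducible ∧
              isotypicComponent (MonoidAlgebra ℂ (localPi E c N J v)) (Representation.asModule (σ.comp (inclPlace F E c N J v)))
                (Representation.asModule τ) = ⊤) ∧
            (τ.IsIrreducible ∧
              isotypicComponent (MonoidAlgebra ℂ (localPi E c N J v)) (Representation.asModule (ω.comp (inclPlace F E c N J v)))
                (Representation.asModule τ) = ⊤)) →
          ∃ f : σ.IntertwiningMap ω, Function.Injective f)
    (hCI :
      ∀ (L : Type) [Field L] [NumberField L] [IsCMField L] (H : Matrix (Fin 3) (Fin 3) L)
        {n' : ℕ} (e₁ : Fin 3 × Fin 1 ≃ Fin n') (dV : Fin 3 → L) (hdV : ∀ i, IsCMField.complexConj L (dV i) = dV i) (hdV0 : ∀ i, dV i ≠ 0)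
        (g : GL (Fin 3) L),
        ((g : Matrix (Fin 3) (Fin 3) L).map (cmConjRingHom L))ᵀ * H * (g : Matrix (Fin 3) (Fin 3) L) = Matrix.diagonal dV →
        ∀ (ιV : finAdelic (↥(maximalRealSubfield L)) L (IsCMField.complexConj L) 3 H →*
            finAdelic (↥(maximalRealSubfield L)) L (IsCMField.complexConj L) 3 (Matrix.diagonal dV)),
          (∀ k, ((ιV k : finAdelic (↥(maximalRealSubfield L)) L (IsCMField.complexConj L) 3 (Matrix.diagonal dV)) :
              GL (Fin 3) (FiniteAdeleRing (𝓞 L) L)) =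
            (toFinAdeleGL L 3 g)⁻¹ * (k : GL (Fin 3) (FiniteAdeleRing (𝓞 L) L)) * toFinAdeleGL L 3 g) →
          ∀ (μ : Literature.NumberTheory.Automorphic.IdeleClassGroup L →ₜ* Circle) (hμ : IsConjugateSymplectic L μ), HasWeight L μ 1 →
            ∀ (a : (↥(maximalRealSubfield L))ˣ) (χ : Chi (↥(maximalRealSubfield L)) L (IsCMField.complexConj L)),
              (rhoAtLine (↥(maximalRealSubfield L)) L (IsCMField.complexConj L) 3 e₁ (Matrix.diagonal dV) (complexConj_imagUnit L)
                  (imagUnit_ne_zero L) (imagUnit_mul_self L) (realDiagonal_isSymm L dV hdV) (isUnit_det_realDiagonal L dV hdV hdV0)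
                  (realDiagonal_map L dV hdV).symm
                  (fun a => isCompatible_chiSplittingLine L e₁ dV hdV hdV0 (toHeckeCharacter L μ) (isUnitary_toHeckeCharacter L μ)
                    ((isOscillatorChar_toHeckeCharacter_iff μ).mpr hμ) (TW (↥(maximalRealSubfield L)) a)
                    (isSymm_TW (↥(maximalRealSubfield L)) a) (isUnit_det_TW (↥(maximalRealSubfield L)) a)
                    (JW (↥(maximalRealSubfield L)) L a) (JW_eq (↥(maximalRealSubfield L)) L a)) ιV a χ).IsIrreducible ∧
              (rhoAtLine (↥(maximalRealSubfield L)) L (IsCMField.complexConj L) 3 e₁ (Matrix.diagonal dV) (complexConj_imagUnit L)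
                  (imagUnit_ne_zero L) (imagUnit_mul_self L) (realDiagonal_isSymm L dV hdV) (isUnit_det_realDiagonal L dV hdV hdV0)
                  (realDiagonal_map L dV hdV).symm
                  (fun a => isCompatible_chiSplittingLine L e₁ dV hdV hdV0 (toHeckeCharacter L μ) (isUnitary_toHeckeCharacter L μ)
                    ((isOscillatorChar_toHeckeCharacter_iff μ).mpr hμ) (TW (↥(maximalRealSubfield L)) a)
                    (isSymm_TW (↥(maximalRealSubfield L)) a) (isUnit_det_TW (↥(maximalRealSubfield L)) a)
                    (JW (↥(maximalRealSubfield L)) L a) (JW_eq (↥(maximalRealSubfield L)) L a)) ιV a χ).IsAdmissible)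
    (hU4 : StubU4SignRule) (hJ3a : HJ3aType) (hocc : HoccType) :
    Summit.HodgeConjecture.HodgeConjecture.Theses.HCCMUnconditional.H413 :=
  Summit.HodgeConjecture.CorCM.Hyp413Closing.H413_of_three_facts_flat
    (oscillatorTriple_dictionaryExistence_holds_of TowerRealisation.stubU1RealisationAt_holds
      (P2StubU2OfLettersCadmD.stub_U2_cohFormsSpectrumIsThetaAt_of_Cadm_D (cohFinComponentIsThetaAdm_of_CE_CF_CI hCE hCF hCI)
        F0P2dSocketD.holCotFormSpectralProjection_holds)
      hU4)
    hJ3a hocc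

end Summit.HodgeConjecture.HodgeConjecture.Cruxes.H413.F0P2cSocketCOfStubs

end
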